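import Literature.RingTheory.FormalGroups.NilpotentEvaluation
import Mathlib.RingTheory.MvPowerSeries.Trunc
import Mathlib.RingTheory.MvPowerSeries.Order
import Mathlib.RingTheory.Nilpotent.Lemmas
import HarnessLib

/-!
# Evaluation of two-variable power series at nilpotent pairs: the algebra of `evalNilp₂`
# ([Bourbaki, Algebra II] Ch. IV §4 no. 3; P6d points currency, desk word (β) 2026-09-01)

Topic `Literature/RingTheory/FormalGroups`; namespace `Literature.RingTheory.FormalGroups`.  THEOREMS ONLY (no definition, no named fact,
no instance, no notation, no `sorry`).  Cell `hodgecm-mathlib`, P6 «MOD programme» ROW 4B: the engine behind the P6d dictionary letters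
(`IsPTorsionOfLawVia`, HL-D) — `F`-addition of nilpotent points `(x, y) ↦ F(x,y) := evalNilp₂ F x y` (★ `NilpotentEvaluation`, p844664).

## Contents

* the BOX form: `evalNilp₂ F x y = Σ_{d ≤ n} F_d x^{d₀} y^{d₁}` (`evalNilp₂_eq_sum_Iic`) for any box `n` with `x^{n₀+1} = y^{n₁+1} = 0`, and
  `evalNilp₂ F x y = MvPolynomial.eval₂ (algebraMap A R) ![x, y] (trunc' A n F)` (`evalNilp₂_eq_eval₂_trunc'`);
* `evalNilp₂_zero∕add∕smul`, **`evalNilp₂_mul`** (Mathlib `coeff_trunc'_mul_trunc'_eq_coeff_mul`), `evalNilp₂_pow`, `evalNilp₂_C`, `evalNilp₂_X₀`,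
  `evalNilp₂_X₁`, `evalNilp₂_one`;
* values: `isNilpotent_evalNilp₂` (`F(0,0) = 0 ⇒ F(x,y)` nilpotent), `isUnit_evalNilp₂` (`F(0,0) ∈ Aˣ ⇒ F(x,y) ∈ Rˣ`).

The composition lemmas («`φ(F)(x,y) = φ(F(x,y))`», «`G(a,b)(x,y) = G(a(x,y), b(x,y))`») and the SEPARATION lemmas («series are determined
by their nilpotent points») are the sibling files `NilpotentEvaluationPairSubst`, `NilpotentPointsSeparation`.
-/

noncomputable section

namespace Literature.RingTheory.FormalGroups

open Finset

universe u v

variable {A : Type u} [CommRing A] {R : Type v} [CommRing R] [Algebra A R]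

/-! ## §1 Box sums -/

/-- The exponent `(i, j)` of `R⟦X,Y⟧` as a finitely supported function. [cite: BourbakiAlgebraII2003, Ch. IV §4 no. 1] -/
theorem single_add_single_apply_zero (i j : ℕ) : (Finsupp.single (0 : Fin 2) i + Finsupp.single 1 j : Fin 2 →₀ ℕ) 0 = i := by simp

/-- The exponent `(i, j)` of `R⟦X,Y⟧` as a finitely supported function. [cite: BourbakiAlgebraII2003, Ch. IV §4 no. 1] -/
theorem single_add_single_apply_one (i j : ℕ) : (Finsupp.single (0 : Fin 2) i + Finsupp.single 1 j : Fin 2 →₀ ℕ) 1 = j := by simp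

/-- Every exponent of `R⟦X,Y⟧` is `(d 0, d 1)`. [cite: BourbakiAlgebraII2003, Ch. IV §4 no. 1] -/
theorem single_add_single_eq (d : Fin 2 →₀ ℕ) : Finsupp.single (0 : Fin 2) (d 0) + Finsupp.single 1 (d 1) = d := by
  ext i; fin_cases i <;> simp

/-- `d ≤ n` in `Fin 2 →₀ ℕ` is the pair of coordinate inequalities. [cite: BourbakiAlgebraII2003, Ch. IV §4 no. 1] -/
theorem le_iff_fin_two {d n : Fin 2 →₀ ℕ} : d ≤ n ↔ d 0 ≤ n 0 ∧ d 1 ≤ n 1 := by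
  rw [Finsupp.le_def]
  constructor
  · exact fun h => ⟨h 0, h 1⟩
  · rintro ⟨h0, h1⟩ i; fin_cases i <;> assumption

/-- **Iterated range sums are box sums**: `Σ_{i ≤ n₀} Σ_{j ≤ n₁} g(i,j) = Σ_{d ≤ n} g(d)`. [cite: BourbakiAlgebraII2003, Ch. IV §4 no. 1] -/
theorem sum_range_sum_range_eq_sum_Iic {M : Type*} [AddCommMonoid M] (n : Fin 2 →₀ ℕ) (g : (Fin 2 →₀ ℕ) → M) :
    ∑ i ∈ range (n 0 + 1), ∑ j ∈ range (n 1 + 1), g (Finsupp.single 0 i + Finsupp.single 1 j) = ∑ d ∈ Finset.Iic n, g d := by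
  rw [← Finset.sum_product']
  refine Finset.sum_nbij' (fun p => Finsupp.single 0 p.1 + Finsupp.single 1 p.2) (fun d => (d 0, d 1)) ?_ ?_ ?_ ?_ ?_
  · intro p hp
    rw [Finset.mem_product, Finset.mem_range, Finset.mem_range] at hp
    rw [Finset.mem_Iic, le_iff_fin_two, single_add_single_apply_zero, single_add_single_apply_one]
    omega
  · intro d hd
    rw [Finset.mem_Iic, le_iff_fin_two] at hd
    rw [Finset.mem_product, Finset.mem_range, Finset.mem_range]
    omega
  · intro p _; simp
  · intro d _; exact single_add_single_eq d
  · intro p _; rfl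

/-- **Box form of `evalNilp₂`**: `F(x,y) = Σ_{d ≤ n} F_d · x^{d₀} y^{d₁}` for every box `n` with `x^{n₀+1} = 0`, `y^{n₁+1} = 0`.
[cite: BourbakiAlgebraII2003, Ch. IV §4 no. 3] -/
theorem evalNilp₂_eq_sum_Iic (F : MvPowerSeries (Fin 2) A) {x y : R} {n : Fin 2 →₀ ℕ} (hx : x ^ (n 0 + 1) = 0) (hy : y ^ (n 1 + 1) = 0) :
    evalNilp₂ F x y = ∑ d ∈ Finset.Iic n, algebraMap A R (MvPowerSeries.coeff d F) * (x ^ d 0 * y ^ d 1) := by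
  rw [evalNilp₂_eq_sum F hx hy, ← sum_range_sum_range_eq_sum_Iic n]
  refine Finset.sum_congr rfl fun i _ => Finset.sum_congr rfl fun j _ => ?_
  rw [single_add_single_apply_zero, single_add_single_apply_one, mul_assoc]

/-- The monomial value `x^{d₀} y^{d₁}` vanishes outside the box. [cite: BourbakiAlgebraII2003, Ch. IV §4 no. 3] -/
theorem pow_mul_pow_eq_zero_of_not_le {x y : R} {n d : Fin 2 →₀ ℕ} (hx : x ^ (n 0 + 1) = 0) (hy : y ^ (n 1 + 1) = 0) (hd : ¬ d ≤ n) :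
    x ^ d 0 * y ^ d 1 = 0 := by
  rw [le_iff_fin_two, not_and_or, not_le, not_le] at hd
  rcases hd with h | h
  · rw [show d 0 = (n 0 + 1) + (d 0 - (n 0 + 1)) by omega, pow_add, hx, zero_mul, zero_mul]
  · rw [show d 1 = (n 1 + 1) + (d 1 - (n 1 + 1)) by omega, pow_add, hy, zero_mul, mul_zero]

/-- Evaluating a POLYNOMIAL at a nilpotent pair as a box sum of its coefficients. [cite: BourbakiAlgebraII2003, Ch. IV §4 no. 3] -/
theorem eval₂_eq_sum_Iic (P : MvPolynomial (Fin 2) A) {x y : R} {n : Fin 2 →₀ ℕ} (hx : x ^ (n 0 + 1) = 0) (hy : y ^ (n 1 + 1) = 0) :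
    MvPolynomial.eval₂ (algebraMap A R) ![x, y] P = ∑ d ∈ Finset.Iic n, algebraMap A R (P.coeff d) * (x ^ d 0 * y ^ d 1) := by
  classical
  rw [MvPolynomial.eval₂_eq']
  simp only [Fin.prod_univ_two, Matrix.cons_val_zero, Matrix.cons_val_one]
  -- both sides are the sum over `support P ∩ Iic n`
  rw [← Finset.sum_filter_add_sum_filter_not P.support (· ≤ n), Finset.sum_eq_zero (s := P.support.filter (¬ · ≤ n))
      (fun d hd => by rw [(Finset.mem_filter.mp hd).2 |> pow_mul_pow_eq_zero_of_not_le hx hy, mul_zero]), add_zero,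
    ← Finset.sum_filter_add_sum_filter_not (Finset.Iic n) (· ∈ P.support),
    Finset.sum_eq_zero (s := (Finset.Iic n).filter (¬ · ∈ P.support))
      (fun d hd => by rw [MvPolynomial.notMem_support_iff.mp (Finset.mem_filter.mp hd).2, map_zero, zero_mul]), add_zero]
  refine Finset.sum_congr ?_ fun _ _ => rfl
  ext d
  simp only [Finset.mem_filter, Finset.mem_Iic]
  tauto

/-- **`evalNilp₂ F x y = eval₂ ![x,y] (trunc' A n F)`** for every box `n` with `x^{n₀+1} = y^{n₁+1} = 0`. [cite: BourbakiAlgebraII2003, Ch. IV §4 no. 3] -/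
theorem evalNilp₂_eq_eval₂_trunc' (F : MvPowerSeries (Fin 2) A) {x y : R} {n : Fin 2 →₀ ℕ} (hx : x ^ (n 0 + 1) = 0)
    (hy : y ^ (n 1 + 1) = 0) :
    evalNilp₂ F x y = MvPolynomial.eval₂ (algebraMap A R) ![x, y] (MvPowerSeries.trunc' A n F) := by
  rw [evalNilp₂_eq_sum_Iic F hx hy, eval₂_eq_sum_Iic _ hx hy]
  refine Finset.sum_congr rfl fun d hd => ?_
  rw [MvPowerSeries.coeff_trunc', if_pos (Finset.mem_Iic.mp hd)]

/-- A POLYNOMIAL at a nilpotent pair only sees its truncation to the box. [cite: BourbakiAlgebraII2003, Ch. IV §4 no. 3] -/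
theorem eval₂_eq_eval₂_trunc'_coe (P : MvPolynomial (Fin 2) A) {x y : R} {n : Fin 2 →₀ ℕ} (hx : x ^ (n 0 + 1) = 0)
    (hy : y ^ (n 1 + 1) = 0) :
    MvPolynomial.eval₂ (algebraMap A R) ![x, y] P =
      MvPolynomial.eval₂ (algebraMap A R) ![x, y] (MvPowerSeries.trunc' A n (P : MvPowerSeries (Fin 2) A)) := by
  rw [eval₂_eq_sum_Iic P hx hy, eval₂_eq_sum_Iic _ hx hy]
  refine Finset.sum_congr rfl fun d hd => ?_
  rw [MvPowerSeries.coeff_trunc', if_pos (Finset.mem_Iic.mp hd), MvPolynomial.coeff_coe]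

/-- A box for a nilpotent pair: from `x^N = 0`, `y^M = 0` the box `n = (N, M)` has `x^{n₀+1} = 0`, `y^{n₁+1} = 0`.
[cite: BourbakiAlgebraII2003, Ch. IV §4 no. 3] -/
theorem exists_box {x y : R} (hx : IsNilpotent x) (hy : IsNilpotent y) :
    ∃ n : Fin 2 →₀ ℕ, x ^ (n 0 + 1) = 0 ∧ y ^ (n 1 + 1) = 0 := by
  obtain ⟨N, hN⟩ := hx
  obtain ⟨M, hM⟩ := hy
  refine ⟨Finsupp.single 0 N + Finsupp.single 1 M, ?_, ?_⟩
  · rw [single_add_single_apply_zero, pow_succ, hN, zero_mul]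
  · rw [single_add_single_apply_one, pow_succ, hM, zero_mul]

/-! ## §2 Ring-homomorphism identities -/

/-- `0(x,y) = 0`. [cite: BourbakiAlgebraII2003, Ch. IV §4 no. 3] -/
@[simp] theorem evalNilp₂_zero (x y : R) : evalNilp₂ (0 : MvPowerSeries (Fin 2) A) x y = 0 := by
  by_cases h : IsNilpotent x ∧ IsNilpotent y
  · obtain ⟨n, hx, hy⟩ := exists_box h.1 h.2; simp [evalNilp₂_eq_sum_Iic 0 hx hy]
  · exact evalNilp₂_of_not h

/-- Additivity. [cite: BourbakiAlgebraII2003, Ch. IV §4 no. 3] -/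
theorem evalNilp₂_add (F G : MvPowerSeries (Fin 2) A) (x y : R) : evalNilp₂ (F + G) x y = evalNilp₂ F x y + evalNilp₂ G x y := by
  by_cases h : IsNilpotent x ∧ IsNilpotent y
  · obtain ⟨n, hx, hy⟩ := exists_box h.1 h.2
    simp only [evalNilp₂_eq_sum_Iic _ hx hy, map_add, add_mul, Finset.sum_add_distrib]
  · simp [evalNilp₂_of_not h]

/-- **Multiplicativity: `(F·G)(x,y) = F(x,y)·G(x,y)`** (box-truncated Cauchy product; Mathlib `coeff_trunc'_mul_trunc'_eq_coeff_mul`).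
[cite: BourbakiAlgebraII2003, Ch. IV §4 no. 3] -/
theorem evalNilp₂_mul (F G : MvPowerSeries (Fin 2) A) (x y : R) : evalNilp₂ (F * G) x y = evalNilp₂ F x y * evalNilp₂ G x y := by
  by_cases h : IsNilpotent x ∧ IsNilpotent y
  · obtain ⟨n, hx, hy⟩ := exists_box h.1 h.2
    have hpoly : MvPowerSeries.trunc' A n (F * G) =
        MvPowerSeries.trunc' A n ((MvPowerSeries.trunc' A n F * MvPowerSeries.trunc' A n G : MvPolynomial (Fin 2) A) :
          MvPowerSeries (Fin 2) A) := by
      ext m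
      rw [MvPowerSeries.coeff_trunc', MvPowerSeries.coeff_trunc']
      split_ifs with hm
      · rw [MvPolynomial.coeff_coe, MvPowerSeries.coeff_trunc'_mul_trunc'_eq_coeff_mul n F G hm]
      · rfl
    rw [evalNilp₂_eq_eval₂_trunc' _ hx hy, evalNilp₂_eq_eval₂_trunc' _ hx hy, evalNilp₂_eq_eval₂_trunc' _ hx hy, hpoly,
      ← eval₂_eq_eval₂_trunc'_coe _ hx hy, MvPolynomial.eval₂_mul]
  · simp [evalNilp₂_of_not h]

/-- Constants: `(C a)(x,y) = a` at a nilpotent pair. [cite: BourbakiAlgebraII2003, Ch. IV §4 no. 3] -/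
theorem evalNilp₂_C {x y : R} (hx : IsNilpotent x) (hy : IsNilpotent y) (a : A) :
    evalNilp₂ (MvPowerSeries.C a : MvPowerSeries (Fin 2) A) x y = algebraMap A R a := by
  classical
  obtain ⟨n, hxn, hyn⟩ := exists_box hx hy
  rw [evalNilp₂_eq_sum_Iic _ hxn hyn, Finset.sum_eq_single 0]
  · simp
  · intro d _ hd
    rw [MvPowerSeries.coeff_C, if_neg hd, map_zero, zero_mul]
  · intro h0; exact absurd (Finset.mem_Iic.mpr bot_le) h0

/-- `1(x,y) = 1` at a nilpotent pair. [cite: BourbakiAlgebraII2003, Ch. IV §4 no. 3] -/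
theorem evalNilp₂_one {x y : R} (hx : IsNilpotent x) (hy : IsNilpotent y) : evalNilp₂ (1 : MvPowerSeries (Fin 2) A) x y = 1 := by
  rw [← map_one MvPowerSeries.C, evalNilp₂_C hx hy, map_one]

/-- The first variable: `X₀(x,y) = x`. [cite: BourbakiAlgebraII2003, Ch. IV §4 no. 3] -/
theorem evalNilp₂_X₀ {x y : R} (hx : IsNilpotent x) (hy : IsNilpotent y) : evalNilp₂ (MvPowerSeries.X 0 : MvPowerSeries (Fin 2) A) x y = x := by
  classical
  obtain ⟨N, hN⟩ := hx
  obtain ⟨n, hxn, hyn⟩ := exists_box (⟨N + 1, by rw [pow_succ, hN, zero_mul]⟩ : IsNilpotent x) hy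
  -- use a box with `n 0 ≥ 1`: enlarge to `n + single 0 1`
  have h0 : (n + Finsupp.single 0 1 : Fin 2 →₀ ℕ) 0 = n 0 + 1 := by simp
  have h1 : (n + Finsupp.single 0 1 : Fin 2 →₀ ℕ) 1 = n 1 := by simp
  have hxn' : x ^ ((n + Finsupp.single 0 1 : Fin 2 →₀ ℕ) 0 + 1) = 0 := by rw [h0, pow_succ, hxn, zero_mul]
  have hyn' : y ^ ((n + Finsupp.single 0 1 : Fin 2 →₀ ℕ) 1 + 1) = 0 := by rw [h1, hyn]
  rw [evalNilp₂_eq_sum_Iic _ hxn' hyn', Finset.sum_eq_single (Finsupp.single 0 1)]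
  · simp [MvPowerSeries.coeff_X]
  · intro d _ hd
    rw [MvPowerSeries.coeff_X, if_neg hd, map_zero, zero_mul]
  · intro h
    exact absurd (Finset.mem_Iic.mpr (le_iff_fin_two.mpr ⟨by simp, by simp⟩)) h

/-- The second variable: `X₁(x,y) = y`. [cite: BourbakiAlgebraII2003, Ch. IV §4 no. 3] -/
theorem evalNilp₂_X₁ {x y : R} (hx : IsNilpotent x) (hy : IsNilpotent y) : evalNilp₂ (MvPowerSeries.X 1 : MvPowerSeries (Fin 2) A) x y = y := by
  classical
  obtain ⟨n, hxn, hyn⟩ := exists_box hx hy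
  have h0 : (n + Finsupp.single 1 1 : Fin 2 →₀ ℕ) 0 = n 0 := by simp
  have h1 : (n + Finsupp.single 1 1 : Fin 2 →₀ ℕ) 1 = n 1 + 1 := by simp
  have hxn' : x ^ ((n + Finsupp.single 1 1 : Fin 2 →₀ ℕ) 0 + 1) = 0 := by rw [h0, hxn]
  have hyn' : y ^ ((n + Finsupp.single 1 1 : Fin 2 →₀ ℕ) 1 + 1) = 0 := by rw [h1, pow_succ, hyn, zero_mul]
  rw [evalNilp₂_eq_sum_Iic _ hxn' hyn', Finset.sum_eq_single (Finsupp.single 1 1)]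
  · simp [MvPowerSeries.coeff_X]
  · intro d _ hd
    rw [MvPowerSeries.coeff_X, if_neg hd, map_zero, zero_mul]
  · intro h
    exact absurd (Finset.mem_Iic.mpr (le_iff_fin_two.mpr ⟨by simp, by simp⟩)) h

/-- Powers at a nilpotent pair. [cite: BourbakiAlgebraII2003, Ch. IV §4 no. 3] -/
theorem evalNilp₂_pow {x y : R} (hx : IsNilpotent x) (hy : IsNilpotent y) (F : MvPowerSeries (Fin 2) A) (k : ℕ) :
    evalNilp₂ (F ^ k) x y = evalNilp₂ F x y ^ k := by
  induction k with
  | zero => rw [pow_zero, pow_zero, evalNilp₂_one hx hy]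
  | succ k ih => rw [pow_succ, pow_succ, evalNilp₂_mul, ih]

/-- Monomials: `(X₀^i X₁^j · G)(x,y) = x^i y^j · G(x,y)`. [cite: BourbakiAlgebraII2003, Ch. IV §4 no. 3] -/
theorem evalNilp₂_X_pow_mul_X_pow_mul {x y : R} (hx : IsNilpotent x) (hy : IsNilpotent y) (i j : ℕ) (G : MvPowerSeries (Fin 2) A) :
    evalNilp₂ ((MvPowerSeries.X 0) ^ i * (MvPowerSeries.X 1) ^ j * G) x y = x ^ i * y ^ j * evalNilp₂ G x y := by
  rw [evalNilp₂_mul, evalNilp₂_mul, evalNilp₂_pow hx hy, evalNilp₂_pow hx hy, evalNilp₂_X₀ hx hy, evalNilp₂_X₁ hx hy]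

/-! ## §3 Values -/

/-- `F(0,0) = 0` ⇒ `F(x,y)` lies in the ideal `(x, y)`, hence is NILPOTENT. [cite: BourbakiAlgebraII2003, Ch. IV §4 no. 3] -/
theorem isNilpotent_evalNilp₂ {F : MvPowerSeries (Fin 2) A} (hF : MvPowerSeries.constantCoeff F = 0) (x y : R) :
    IsNilpotent (evalNilp₂ F x y) := by
  classical
  by_cases h : IsNilpotent x ∧ IsNilpotent y
  · obtain ⟨n, hx, hy⟩ := exists_box h.1 h.2
    rw [evalNilp₂_eq_sum_Iic F hx hy, ← mem_nilradical]
    refine Ideal.sum_mem _ fun d _ => ?_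
    by_cases hd : d = 0
    · subst hd
      rw [MvPowerSeries.coeff_zero_eq_constantCoeff_apply, hF, map_zero, zero_mul]
      exact Ideal.zero_mem _
    · refine Ideal.mul_mem_left _ _ ?_
      have : d 0 ≠ 0 ∨ d 1 ≠ 0 := by
        by_contra hcon
        simp only [not_or, not_ne_iff] at hcon
        exact hd (by rw [← single_add_single_eq d, hcon.1, hcon.2]; simp)
      rcases this with h0 | h1
      · exact Ideal.mul_mem_right _ _ (mem_nilradical.mpr (h.1.pow_of_pos h0))
      · exact Ideal.mul_mem_left _ _ (mem_nilradical.mpr (h.2.pow_of_pos h1))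
  · rw [evalNilp₂_of_not h]; exact IsNilpotent.zero

/-- **`F(0,0) ∈ Aˣ ⇒ F(x,y) ∈ Rˣ`** at a nilpotent pair (unit + nilpotent). [cite: BourbakiAlgebraII2003, Ch. IV §4 no. 4] -/
theorem isUnit_evalNilp₂ {x y : R} (hx : IsNilpotent x) (hy : IsNilpotent y) {F : MvPowerSeries (Fin 2) A}
    (hF : IsUnit (MvPowerSeries.constantCoeff F)) : IsUnit (evalNilp₂ F x y) := by
  have hsplit : F = MvPowerSeries.C (MvPowerSeries.constantCoeff F) + (F - MvPowerSeries.C (MvPowerSeries.constantCoeff F)) := by ring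
  rw [hsplit, evalNilp₂_add, evalNilp₂_C hx hy]
  exact (isNilpotent_evalNilp₂ (by simp) x y).isUnit_add_left_of_commute (hF.map _) (Commute.all _ _)

end Literature.RingTheory.FormalGroups
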